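import Literature.Analysis.Fourier.WirtingerDirichlet
import Literature.Analysis.Fourier.WirtingerOneSided
import Summits.NavierStokesRegularity.OSWSelfSimilar.SheetRCayleySubstitution
import HarnessLib

/-!
# SHEET-ℝ frame, (E5) `𝒰`-term: `‖𝒰δ‖²_{L²(dθ)} ≤ ‖Hδ‖²_w/(2L)` from the Dirichlet–Wirtinger inequality

HONEST FRAMING (cell ns-blowup GROUP B / zone Z3, case Z3-SR-CERT; 1-D MODEL certificate frame; not Euler/NS).

In the high-pass lemma (E5) of the certificate chain (cert-1 `SHEET-R-PRICE-impl1.md` §1; `DESIGN-INTERVAL.md` l.46–47: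
`D = (λ/2 + S₁)(2L)^{-1/2} + S₁′·2(2/L³)^{1/2} + a(S₂ + S₂′)·2(2L)^{-1/2}`) the `S₂′`-term bounds `‖r_θ·𝒰δ‖_{L²(dθ)}` by
`sup|r_θ|·2(2L)^{-1/2}‖δ‖_E`, i.e. uses **`‖𝒰δ‖_{L²(dθ)} ≤ (2L)^{-1/2}‖δ‖_w`** (`‖δ‖_w ≤ 2‖δ‖_E`); the second implementation (cert-2
F5(b) part 1, STATUS 2026-08-26 23:54Z) obtained `π/√2` in place of `1` by Cauchy–Schwarz and flagged the discrepancy. With the Cayley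
variable `ξ = L tan(θ/2)` and `F(θ) := 𝒰δ(ξ)`: `F(0) = 0`, `∫_{−π}^{π} F′² dθ = ‖Hδ‖²_w/(2L)` and `‖𝒰δ‖²_{L²(dθ)} = ∫_{−π}^{π}F²`, so the
constant `1` is the DIRICHLET–WIRTINGER inequality on the two half intervals (`Literature.Analysis.Fourier.integral_sq_le_integral_deriv_sq_symm`,
Hardy–Littlewood–Pólya Thm 257), which needs `F(±π) = 0`, i.e. **`𝒰δ(ξ) → 0` as `ξ → ±∞`** (the «π-endpoint sentence»; on the energy
class: `∫_ℝ Hδ = 0`). With only `F(0) = 0` the sharp constant would be `4` (extremal `F = sin(θ/2)`, i.e. `Hδ ∝ (L² + ξ²)^{-3/2}`), so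
the endpoint hypothesis cannot be dropped. This file proves the ξ-form:

  **`U(0) = 0`, `U′ = u` continuous, `∫(L²+ξ²)u² < ∞`, `U → 0` at `±∞`  ⇒  `∫ U(ξ)²·2L/(L²+ξ²) dξ ≤ (2L)⁻¹·∫(L²+ξ²)u(ξ)² dξ`**

(`integral_velocity_sq_le`; for `U = 𝒰δ`, `u = Hδ` and the tree's isometry `‖Hδ‖_w = ‖δ‖_w` this is PRICE's multiplier,
`integral_velocity_sq_le_of_weightedSq_eq`). Pure 1-D calculus on explicit hypotheses; no definition, no named fact, nothing asserted about
any profile. MODEL frame bookkeeping only.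
-/

noncomputable section

namespace Summit.NavierStokesRegularity.OSWSelfSimilar
namespace SheetRVelocityWirtinger

open _root_.MeasureTheory _root_.Set _root_.Filter _root_.Real intervalIntegral
open scoped Real Topology
open Literature.Analysis.Fourier SheetRCayleySubstitution

/-- `Φ(θ) = L tan(θ/2) → +∞` as `θ → π⁻` (`L > 0`). [folklore] -/
theorem tendsto_cayley_atTop {L : ℝ} (hL : 0 < L) : Tendsto (fun θ : ℝ => L * tan (θ / 2)) (𝓝[<] π) atTop := by
  have h1 : Tendsto (fun θ : ℝ => θ / 2) (𝓝[<] π) (𝓝[<] (π / 2)) := by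
    refine tendsto_nhdsWithin_of_tendsto_nhds_of_eventually_within _ ?_ ?_
    · have := ((continuous_id.div_const (2:ℝ)).tendsto π).mono_left (nhdsWithin_le_nhds (s := Iio π))
      simpa using this
    · filter_upwards [self_mem_nhdsWithin] with x (hx : x < π)
      exact (div_lt_div_iff_of_pos_right two_pos).2 hx
  exact (Real.tendsto_tan_pi_div_two.comp h1).const_mul_atTop hL

/-- `Φ(θ) = L tan(θ/2) → −∞` as `θ → (−π)⁺` (`L > 0`). [folklore] -/
theorem tendsto_cayley_atBot {L : ℝ} (hL : 0 < L) : Tendsto (fun θ : ℝ => L * tan (θ / 2)) (𝓝[>] (-π)) atBot := by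
  have h1 : Tendsto (fun θ : ℝ => θ / 2) (𝓝[>] (-π)) (𝓝[>] (-(π / 2))) := by
    refine tendsto_nhdsWithin_of_tendsto_nhds_of_eventually_within _ ?_ ?_
    · have := ((continuous_id.div_const (2:ℝ)).tendsto (-π)).mono_left (nhdsWithin_le_nhds (s := Ioi (-π)))
      simpa [neg_div] using this
    · filter_upwards [self_mem_nhdsWithin] with x (hx : -π < x)
      have : -π / 2 < x / 2 := (div_lt_div_iff_of_pos_right two_pos).2 hx
      simpa [neg_div] using this
  exact (Real.tendsto_tan_neg_pi_div_two.comp h1).const_mul_atBot hL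

/-- **The `𝒰`-term inequality of (E5)** (`L > 0`): if `U(0) = 0`, `U′ = u` everywhere with `u` continuous, `∫(L² + ξ²)u² < ∞`, and
`U(ξ) → 0` as `ξ → +∞` and as `ξ → −∞`, then `∫ U(ξ)²·2L/(L² + ξ²) dξ ≤ (2L)⁻¹·∫ (L² + ξ²) u(ξ)² dξ` — for `U = 𝒰δ`, `u = Hδ`:
`‖𝒰δ‖²_{L²(dθ)} ≤ ‖Hδ‖²_w/(2L)`, the sharp Dirichlet–Wirtinger constant. [folklore] -/
theorem integral_velocity_sq_le {L : ℝ} (hL : 0 < L) {U u : ℝ → ℝ} (hU : ∀ ξ, HasDerivAt U (u ξ) ξ) (hu : Continuous u)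
    (hU0 : U 0 = 0) (hwu : Integrable fun ξ => (L ^ 2 + ξ ^ 2) * u ξ ^ 2) (htop : Tendsto U atTop (𝓝 0))
    (hbot : Tendsto U atBot (𝓝 0)) :
    ∫ ξ, U ξ ^ 2 * (2 * L / (L ^ 2 + ξ ^ 2)) ≤ (2 * L)⁻¹ * ∫ ξ, (L ^ 2 + ξ ^ 2) * u ξ ^ 2 := by
  have hL0 : L ≠ 0 := hL.ne'
  have hπ : 0 < π := Real.pi_pos
  have hππ : (-π : ℝ) < π := by linarith
  have hUc : Continuous U := continuous_iff_continuousAt.2 fun ξ => (hU ξ).continuousAt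
  set Φ : ℝ → ℝ := fun θ => L * tan (θ / 2) with hΦ
  set F : ℝ → ℝ := fun θ => if θ ∈ Ioo (-π) π then U (Φ θ) else 0 with hFdef
  set f : ℝ → ℝ := fun θ => u (Φ θ) * (L / (2 * cos (θ / 2) ^ 2)) with hfdef
  have hΦd : ∀ θ ∈ Ioo (-π) π, HasDerivAt Φ (L / (2 * cos (θ / 2) ^ 2)) θ := fun θ hθ => hasDerivAt_cayley L hθ
  have hΦc : ContinuousOn Φ (Ioo (-π) π) := fun θ hθ => (hΦd θ hθ).continuousAt.continuousWithinAt
  have hFeq : ∀ θ ∈ Ioo (-π) π, F θ = U (Φ θ) := fun θ hθ => by simp only [hFdef]; exact if_pos hθ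
  -- derivative on the open interval
  have hFd : ∀ θ ∈ Ioo (-π) π, HasDerivAt F (f θ) θ := by
    intro θ hθ
    have h : HasDerivAt (fun θ => U (Φ θ)) (f θ) θ := by
      have := (hU (Φ θ)).comp θ (hΦd θ hθ)
      simpa [hfdef, Function.comp_def] using this
    refine h.congr_of_eventuallyEq ?_
    filter_upwards [isOpen_Ioo.mem_nhds hθ] with x hx
    exact hFeq x hx
  -- the derivative is continuous on the open interval
  have hcos : ∀ θ ∈ Ioo (-π) π, cos (θ / 2) ≠ 0 := fun θ hθ => (cos_half_pos hθ).ne'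
  have hjc : ContinuousOn (fun θ : ℝ => L / (2 * cos (θ / 2) ^ 2)) (Ioo (-π) π) :=
    continuousOn_const.div (by fun_prop) fun θ hθ => mul_ne_zero two_ne_zero (pow_ne_zero 2 (hcos θ hθ))
  have hfc : ContinuousOn f (Ioo (-π) π) := (hu.comp_continuousOn hΦc).mul hjc
  -- continuity of `F` on the closed interval: interior from the derivative, endpoints from the limits of `U`
  have hFc : ContinuousOn F (Icc (-π) π) := by
    intro θ hθ
    rcases eq_or_lt_of_le hθ.1 with h1 | h1
    · -- θ = −π
      rw [← h1]
      have hval : F (-π) = 0 := by simp [hFdef]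
      have key : Tendsto F (𝓝[>] (-π)) (𝓝 (F (-π))) := by
        rw [hval]
        refine (hbot.comp (tendsto_cayley_atBot hL)).congr' ?_
        filter_upwards [Ioo_mem_nhdsGT hππ] with x hx
        exact (hFeq x hx).symm
      have h2 : ContinuousWithinAt F (Ici (-π)) (-π) := continuousWithinAt_Ioi_iff_Ici.mp key
      exact h2.mono fun x hx => hx.1
    rcases eq_or_lt_of_le hθ.2 with h2 | h2
    · -- θ = π
      rw [h2]
      have hval : F π = 0 := by simp [hFdef]
      have key : Tendsto F (𝓝[<] π) (𝓝 (F π)) := by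
        rw [hval]
        refine (htop.comp (tendsto_cayley_atTop hL)).congr' ?_
        filter_upwards [Ioo_mem_nhdsLT hππ] with x hx
        exact (hFeq x hx).symm
      have h3 : ContinuousWithinAt F (Iic π) π := continuousWithinAt_Iio_iff_Iic.mp key
      exact h3.mono fun x hx => hx.2
    · exact (hFd θ ⟨h1, h2⟩).continuousAt.continuousWithinAt
  -- the pointwise dictionary on the open interval
  have hjac : ∀ θ ∈ Ioo (-π) π, L / (2 * cos (θ / 2) ^ 2) = (L ^ 2 + Φ θ ^ 2) / (2 * L) := by
    intro θ hθ
    rw [hΦ]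
    simp only
    rw [weight_cayley L hθ]
    have hc := hcos θ hθ
    field_simp
  have hf2_pt : ∀ θ ∈ Ioo (-π) π,
      (L / (2 * cos (θ / 2) ^ 2)) * ((L ^ 2 + Φ θ ^ 2) * u (Φ θ) ^ 2 / (2 * L)) = f θ ^ 2 := by
    intro θ hθ
    rw [hfdef]
    simp only
    rw [hjac θ hθ]
    ring
  have hF2_pt : ∀ θ ∈ Ioo (-π) π,
      (L / (2 * cos (θ / 2) ^ 2)) * (U (Φ θ) ^ 2 * (2 * L / (L ^ 2 + Φ θ ^ 2))) = F θ ^ 2 := by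
    intro θ hθ
    rw [hFeq θ hθ, hjac θ hθ]
    have hw : 0 < L ^ 2 + Φ θ ^ 2 := by positivity
    field_simp
  -- integrability of `f²` and `f` on the interval
  have hg_int : Integrable fun ξ => (L ^ 2 + ξ ^ 2) * u ξ ^ 2 / (2 * L) := hwu.div_const _
  have hf2_on : IntegrableOn (fun θ => f θ ^ 2) (Ioo (-π) π) :=
    (((integrable_iff_integrableOn_comp_cayley hL _).mp hg_int).congr_fun hf2_pt measurableSet_Ioo)
  have hf2 : IntervalIntegrable (fun θ => f θ ^ 2) volume (-π) π := by
    rw [intervalIntegrable_iff_integrableOn_Ioo_of_le hππ.le]; exact hf2_on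
  have hf1 : IntervalIntegrable f volume (-π) π := by
    rw [intervalIntegrable_iff_integrableOn_Ioo_of_le hππ.le]
    have hmeas : AEStronglyMeasurable f (volume.restrict (Ioo (-π) π)) := hfc.aestronglyMeasurable measurableSet_Ioo
    have hdom : IntegrableOn (fun θ => (1 + f θ ^ 2) / 2) (Ioo (-π) π) :=
      ((integrableOn_const (by simp)).add hf2_on).div_const 2
    refine Integrable.mono' hdom hmeas (ae_of_all _ fun θ => ?_)
    rw [Real.norm_eq_abs]
    nlinarith [sq_nonneg (|f θ| - 1), sq_abs (f θ)]
  -- the Dirichlet–Wirtinger inequality on `(−π, π)`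
  have hF0 : F 0 = 0 := by
    rw [hFeq 0 ⟨by linarith, hπ⟩, hΦ]
    simp [hU0]
  have hW := integral_sq_le_integral_deriv_sq_symm hFd hFc hfc hf1 hf2 (by simp [hFdef]) hF0 (by simp [hFdef])
  -- back to `ξ`
  have hLHS : ∫ ξ, U ξ ^ 2 * (2 * L / (L ^ 2 + ξ ^ 2)) = ∫ θ in (-π)..π, F θ ^ 2 := by
    rw [integral_comp_cayley hL, intervalIntegral.integral_of_le hππ.le, integral_Ioc_eq_integral_Ioo]
    exact setIntegral_congr_fun measurableSet_Ioo hF2_pt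
  have hRHS : (2 * L)⁻¹ * ∫ ξ, (L ^ 2 + ξ ^ 2) * u ξ ^ 2 = ∫ θ in (-π)..π, f θ ^ 2 := by
    rw [← MeasureTheory.integral_const_mul]
    have e : (fun ξ => (2 * L)⁻¹ * ((L ^ 2 + ξ ^ 2) * u ξ ^ 2)) = fun ξ => (L ^ 2 + ξ ^ 2) * u ξ ^ 2 / (2 * L) := by
      funext ξ; ring
    rw [e, integral_comp_cayley hL, intervalIntegral.integral_of_le hππ.le, integral_Ioc_eq_integral_Ioo]
    exact setIntegral_congr_fun measurableSet_Ioo hf2_pt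
  rw [hLHS, hRHS]
  exact hW

/-- The same with an ISOMETRY input («`‖Hδ‖_w = ‖δ‖_w`», tree: `SheetREnergyClass.weightedSq_hilbertTransform_of_primitive`, cert-2's
`HilbertTransformLineWeightedL2`): if moreover `∫(L²+ξ²)u² = ∫(L²+ξ²)δ²` then `∫ U²·2L/(L²+ξ²) ≤ (2L)⁻¹∫(L²+ξ²)δ²`, i.e.
**`‖𝒰δ‖_{L²(dθ)} ≤ (2L)^{-1/2}‖δ‖_w`** — PRICE-impl1 (E5)'s `S₂′` multiplier `2/(2L)^{1/2}` after `‖δ‖_w ≤ 2‖δ‖_E`. [folklore] -/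
theorem integral_velocity_sq_le_of_weightedSq_eq {L : ℝ} (hL : 0 < L) {U u δ : ℝ → ℝ} (hU : ∀ ξ, HasDerivAt U (u ξ) ξ)
    (hu : Continuous u) (hU0 : U 0 = 0) (hwu : Integrable fun ξ => (L ^ 2 + ξ ^ 2) * u ξ ^ 2) (htop : Tendsto U atTop (𝓝 0))
    (hbot : Tendsto U atBot (𝓝 0)) (hiso : ∫ ξ, (L ^ 2 + ξ ^ 2) * u ξ ^ 2 = ∫ ξ, (L ^ 2 + ξ ^ 2) * δ ξ ^ 2) :
    ∫ ξ, U ξ ^ 2 * (2 * L / (L ^ 2 + ξ ^ 2)) ≤ (2 * L)⁻¹ * ∫ ξ, (L ^ 2 + ξ ^ 2) * δ ξ ^ 2 := by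
  rw [← hiso]; exact integral_velocity_sq_le hL hU hu hU0 hwu htop hbot

/-- Square-root form: `(∫ U²·2L/(L²+ξ²))^{1/2} ≤ (2L)^{-1/2}·(∫(L²+ξ²)u²)^{1/2}` («`‖𝒰δ‖_{L²(dθ)} ≤ (2L)^{-1/2}‖Hδ‖_w`»). [folklore] -/
theorem sqrt_integral_velocity_sq_le {L : ℝ} (hL : 0 < L) {U u : ℝ → ℝ} (hU : ∀ ξ, HasDerivAt U (u ξ) ξ) (hu : Continuous u)
    (hU0 : U 0 = 0) (hwu : Integrable fun ξ => (L ^ 2 + ξ ^ 2) * u ξ ^ 2) (htop : Tendsto U atTop (𝓝 0))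
    (hbot : Tendsto U atBot (𝓝 0)) :
    Real.sqrt (∫ ξ, U ξ ^ 2 * (2 * L / (L ^ 2 + ξ ^ 2))) ≤
      (Real.sqrt (2 * L))⁻¹ * Real.sqrt (∫ ξ, (L ^ 2 + ξ ^ 2) * u ξ ^ 2) := by
  have h := integral_velocity_sq_le hL hU hu hU0 hwu htop hbot
  have h2L : 0 < 2 * L := by positivity
  calc Real.sqrt (∫ ξ, U ξ ^ 2 * (2 * L / (L ^ 2 + ξ ^ 2)))
      ≤ Real.sqrt ((2 * L)⁻¹ * ∫ ξ, (L ^ 2 + ξ ^ 2) * u ξ ^ 2) := Real.sqrt_le_sqrt h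
    _ = (Real.sqrt (2 * L))⁻¹ * Real.sqrt (∫ ξ, (L ^ 2 + ξ ^ 2) * u ξ ^ 2) := by
      rw [Real.sqrt_mul (inv_nonneg.2 h2L.le), Real.sqrt_inv]

/-! ### §4 (appended) The UNCONDITIONAL form: no endpoint hypothesis, constant `4` (one-sided Wirtinger, HLP Thm 256) -/

/-- One-sided Wirtinger on `(−π, π)` through the origin: `F` continuous and bounded on `(−π, π)`, differentiable there with derivative `f`
continuous, `f, f² ∈ L¹`, `F(0) = 0` ⇒ `∫_{−π}^{π} F² ≤ 4·∫_{−π}^{π} f²` (HLP Thm 256 on each half, by reflection). [folklore] -/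
theorem integral_sq_le_four_mul_integral_deriv_sq_symm {F f : ℝ → ℝ} (hF : ∀ θ ∈ Ioo (-π) π, HasDerivAt F (f θ) θ)
    (hFb : ∃ M, ∀ θ ∈ Ioo (-π) π, |F θ| ≤ M) (hfc : ContinuousOn f (Ioo (-π) π)) (hf1 : IntervalIntegrable f volume (-π) π)
    (hf2 : IntervalIntegrable (fun θ => f θ ^ 2) volume (-π) π) (hF0 : F 0 = 0) :
    ∫ θ in (-π)..π, F θ ^ 2 ≤ 4 * ∫ θ in (-π)..π, f θ ^ 2 := by
  have hπ : 0 < π := Real.pi_pos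
  obtain ⟨M, hM⟩ := hFb
  have hFc : ContinuousOn F (Ioo (-π) π) := fun θ hθ => (hF θ hθ).continuousAt.continuousWithinAt
  have hsubR : uIcc (0:ℝ) π ⊆ uIcc (-π) π := by
    rw [uIcc_of_le hπ.le, uIcc_of_le (by linarith)]; exact Icc_subset_Icc (by linarith) le_rfl
  have hsubL : uIcc (-π) (0:ℝ) ⊆ uIcc (-π) π := by
    rw [uIcc_of_le (by linarith : (-π:ℝ) ≤ 0), uIcc_of_le (by linarith)]; exact Icc_subset_Icc le_rfl hπ.le
  have hR : ∫ θ in (0:ℝ)..π, F θ ^ 2 ≤ 4 * ∫ θ in (0:ℝ)..π, f θ ^ 2 :=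
    integral_sq_le_four_mul_integral_deriv_sq (fun θ hθ => hF θ ⟨by linarith [hθ.1], hθ.2⟩)
      (hFc.mono fun θ hθ => ⟨by linarith [hθ.1], hθ.2⟩) ⟨M, fun θ hθ => hM θ ⟨by linarith [hθ.1], hθ.2⟩⟩
      (hfc.mono fun θ hθ => ⟨by linarith [hθ.1], hθ.2⟩) (hf1.mono_set hsubR) (hf2.mono_set hsubR) hF0
  have hL : ∫ θ in (0:ℝ)..π, F (-θ) ^ 2 ≤ 4 * ∫ θ in (0:ℝ)..π, (-f (-θ)) ^ 2 := by
    refine integral_sq_le_four_mul_integral_deriv_sq (F := fun θ => F (-θ)) (f := fun θ => -f (-θ)) ?_ ?_ ?_ ?_ ?_ ?_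
      (by simpa using hF0)
    · intro θ hθ
      have h := (hF (-θ) ⟨by linarith [hθ.2], by linarith [hθ.1]⟩).comp θ (hasDerivAt_neg θ)
      simpa [Function.comp_def] using h
    · exact hFc.comp continuous_neg.continuousOn fun θ hθ => ⟨by linarith [hθ.2], by linarith [hθ.1]⟩
    · exact ⟨M, fun θ hθ => hM (-θ) ⟨by linarith [hθ.2], by linarith [hθ.1]⟩⟩
    · exact (hfc.comp continuous_neg.continuousOn fun θ hθ => ⟨by linarith [hθ.2], by linarith [hθ.1]⟩).neg
    · have h := (IntervalIntegrable.iff_comp_neg (f := f)).mp (hf1.mono_set hsubL)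
      simp only [neg_neg, neg_zero] at h
      exact h.symm.neg
    · have h := (IntervalIntegrable.iff_comp_neg (f := fun θ => f θ ^ 2)).mp (hf2.mono_set hsubL)
      simp only [neg_neg, neg_zero] at h
      refine h.symm.congr fun θ _ => ?_
      simp only [neg_sq]
  have hL' : ∫ θ in (-π)..(0:ℝ), F θ ^ 2 ≤ 4 * ∫ θ in (-π)..(0:ℝ), f θ ^ 2 := by
    have e1 : ∫ θ in (0:ℝ)..π, F (-θ) ^ 2 = ∫ θ in (-π)..(0:ℝ), F θ ^ 2 := by
      rw [intervalIntegral.integral_comp_neg (fun θ => F θ ^ 2)]; simp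
    have e2 : ∫ θ in (0:ℝ)..π, (-f (-θ)) ^ 2 = ∫ θ in (-π)..(0:ℝ), f θ ^ 2 := by
      simp only [neg_sq]
      rw [intervalIntegral.integral_comp_neg (fun θ => f θ ^ 2)]; simp
    rw [← e1, ← e2]; exact hL
  -- `F²` is interval-integrable on `[−π, π]` (bounded, continuous inside)
  have hF2on : IntegrableOn (fun θ => F θ ^ 2) (Ioo (-π) π) := by
    have hmeas : AEStronglyMeasurable (fun θ => F θ ^ 2) (volume.restrict (Ioo (-π) π)) :=
      (hFc.pow 2).aestronglyMeasurable measurableSet_Ioo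
    refine Integrable.mono' (integrableOn_const (by simp) (C := M ^ 2)) hmeas (ae_restrict_of_forall_mem measurableSet_Ioo ?_)
    intro θ hθ
    rw [Real.norm_eq_abs, abs_of_nonneg (sq_nonneg _), ← sq_abs]
    exact pow_le_pow_left₀ (abs_nonneg _) (hM θ hθ) 2
  have hIF : IntervalIntegrable (fun θ => F θ ^ 2) volume (-π) π := by
    rw [intervalIntegrable_iff_integrableOn_Ioo_of_le (by linarith)]; exact hF2on
  rw [← intervalIntegral.integral_add_adjacent_intervals (hIF.mono_set hsubL) (hIF.mono_set hsubR),
    ← intervalIntegral.integral_add_adjacent_intervals (hf2.mono_set hsubL) (hf2.mono_set hsubR)]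
  linarith

/-- **The UNCONDITIONAL `𝒰`-term inequality** (`L > 0`; no endpoint sentence): if `U(0) = 0`, `U′ = u` everywhere with `u` continuous,
`∫(L²+ξ²)u² < ∞`, and `U` is BOUNDED, then `∫ U(ξ)²·2L/(L²+ξ²) dξ ≤ (2/L)·∫(L²+ξ²)u(ξ)² dξ` — for `U = 𝒰δ`, `u = Hδ`:
`‖𝒰δ‖²_{L²(dθ)} ≤ 4‖Hδ‖²_w/(2L)`, i.e. **`‖𝒰δ‖_{L²(dθ)} ≤ 2(2L)^{-1/2}‖δ‖_w ≤ 4(2L)^{-1/2}‖δ‖_E`** = the «Volterra-sharp» constant of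
RULING (dz)/(ei) (`D = 2.63429`), the boundedness of `𝒰δ` being the tree's velocity bound
(`SheetREnergyClass.abs_velocity_le_of_primitive`). Sharp: extremal `F = sin(θ/2)`. [folklore] -/
theorem integral_velocity_sq_le_four_mul {L : ℝ} (hL : 0 < L) {U u : ℝ → ℝ} (hU : ∀ ξ, HasDerivAt U (u ξ) ξ)
    (hu : Continuous u) (hU0 : U 0 = 0) (hwu : Integrable fun ξ => (L ^ 2 + ξ ^ 2) * u ξ ^ 2)
    (hUb : ∃ M, ∀ ξ, |U ξ| ≤ M) :
    ∫ ξ, U ξ ^ 2 * (2 * L / (L ^ 2 + ξ ^ 2)) ≤ (2 / L) * ∫ ξ, (L ^ 2 + ξ ^ 2) * u ξ ^ 2 := by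
  have hL0 : L ≠ 0 := hL.ne'
  have hπ : 0 < π := Real.pi_pos
  have hππ : (-π : ℝ) < π := by linarith
  obtain ⟨M, hM⟩ := hUb
  set Φ : ℝ → ℝ := fun θ => L * tan (θ / 2) with hΦ
  set F : ℝ → ℝ := fun θ => U (Φ θ) with hFdef
  set f : ℝ → ℝ := fun θ => u (Φ θ) * (L / (2 * cos (θ / 2) ^ 2)) with hfdef
  have hΦd : ∀ θ ∈ Ioo (-π) π, HasDerivAt Φ (L / (2 * cos (θ / 2) ^ 2)) θ := fun θ hθ => hasDerivAt_cayley L hθ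
  have hΦc : ContinuousOn Φ (Ioo (-π) π) := fun θ hθ => (hΦd θ hθ).continuousAt.continuousWithinAt
  have hFd : ∀ θ ∈ Ioo (-π) π, HasDerivAt F (f θ) θ := by
    intro θ hθ
    have := (hU (Φ θ)).comp θ (hΦd θ hθ)
    simpa [hFdef, hfdef, Function.comp_def] using this
  have hcos : ∀ θ ∈ Ioo (-π) π, cos (θ / 2) ≠ 0 := fun θ hθ => (cos_half_pos hθ).ne'
  have hjc : ContinuousOn (fun θ : ℝ => L / (2 * cos (θ / 2) ^ 2)) (Ioo (-π) π) :=
    continuousOn_const.div (by fun_prop) fun θ hθ => mul_ne_zero two_ne_zero (pow_ne_zero 2 (hcos θ hθ))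
  have hfc : ContinuousOn f (Ioo (-π) π) := (hu.comp_continuousOn hΦc).mul hjc
  have hjac : ∀ θ ∈ Ioo (-π) π, L / (2 * cos (θ / 2) ^ 2) = (L ^ 2 + Φ θ ^ 2) / (2 * L) := by
    intro θ hθ
    rw [hΦ]
    simp only
    rw [weight_cayley L hθ]
    have hc := hcos θ hθ
    field_simp
  have hf2_pt : ∀ θ ∈ Ioo (-π) π,
      (L / (2 * cos (θ / 2) ^ 2)) * ((L ^ 2 + Φ θ ^ 2) * u (Φ θ) ^ 2 / (2 * L)) = f θ ^ 2 := by
    intro θ hθ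
    rw [hfdef]
    simp only
    rw [hjac θ hθ]
    ring
  have hF2_pt : ∀ θ ∈ Ioo (-π) π,
      (L / (2 * cos (θ / 2) ^ 2)) * (U (Φ θ) ^ 2 * (2 * L / (L ^ 2 + Φ θ ^ 2))) = F θ ^ 2 := by
    intro θ hθ
    rw [hFdef]
    simp only
    rw [hjac θ hθ]
    have hw : 0 < L ^ 2 + Φ θ ^ 2 := by positivity
    field_simp
  have hg_int : Integrable fun ξ => (L ^ 2 + ξ ^ 2) * u ξ ^ 2 / (2 * L) := hwu.div_const _
  have hf2_on : IntegrableOn (fun θ => f θ ^ 2) (Ioo (-π) π) :=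
    (((integrable_iff_integrableOn_comp_cayley hL _).mp hg_int).congr_fun hf2_pt measurableSet_Ioo)
  have hf2 : IntervalIntegrable (fun θ => f θ ^ 2) volume (-π) π := by
    rw [intervalIntegrable_iff_integrableOn_Ioo_of_le hππ.le]; exact hf2_on
  have hf1 : IntervalIntegrable f volume (-π) π := by
    rw [intervalIntegrable_iff_integrableOn_Ioo_of_le hππ.le]
    have hmeas : AEStronglyMeasurable f (volume.restrict (Ioo (-π) π)) := hfc.aestronglyMeasurable measurableSet_Ioo
    have hdom : IntegrableOn (fun θ => (1 + f θ ^ 2) / 2) (Ioo (-π) π) :=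
      ((integrableOn_const (by simp)).add hf2_on).div_const 2
    refine Integrable.mono' hdom hmeas (ae_of_all _ fun θ => ?_)
    rw [Real.norm_eq_abs]
    nlinarith [sq_nonneg (|f θ| - 1), sq_abs (f θ)]
  have hF0 : F 0 = 0 := by
    rw [hFdef, hΦ]
    simp [hU0]
  have hW := integral_sq_le_four_mul_integral_deriv_sq_symm hFd ⟨M, fun θ _ => hM (Φ θ)⟩ hfc hf1 hf2 hF0
  have hLHS : ∫ ξ, U ξ ^ 2 * (2 * L / (L ^ 2 + ξ ^ 2)) = ∫ θ in (-π)..π, F θ ^ 2 := by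
    rw [integral_comp_cayley hL, intervalIntegral.integral_of_le hππ.le, integral_Ioc_eq_integral_Ioo]
    exact setIntegral_congr_fun measurableSet_Ioo hF2_pt
  have hRHS : (2 * L)⁻¹ * ∫ ξ, (L ^ 2 + ξ ^ 2) * u ξ ^ 2 = ∫ θ in (-π)..π, f θ ^ 2 := by
    rw [← MeasureTheory.integral_const_mul]
    have e : (fun ξ => (2 * L)⁻¹ * ((L ^ 2 + ξ ^ 2) * u ξ ^ 2)) = fun ξ => (L ^ 2 + ξ ^ 2) * u ξ ^ 2 / (2 * L) := by
      funext ξ; ring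
    rw [e, integral_comp_cayley hL, intervalIntegral.integral_of_le hππ.le, integral_Ioc_eq_integral_Ioo]
    exact setIntegral_congr_fun measurableSet_Ioo hf2_pt
  have hscale : (2 / L) * ∫ ξ, (L ^ 2 + ξ ^ 2) * u ξ ^ 2 = 4 * ((2 * L)⁻¹ * ∫ ξ, (L ^ 2 + ξ ^ 2) * u ξ ^ 2) := by
    field_simp
    ring
  rw [hLHS, hscale, hRHS]
  exact hW

end SheetRVelocityWirtinger
end Summit.NavierStokesRegularity.OSWSelfSimilar
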